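import Summits.HodgeConjecture.HodgeConjecture.Theorems.VHCAbelianSchemesRoadSecantQuotientAnchorLevelTransferDefs
import Summits.HodgeConjecture.HodgeConjecture.Theorems.VHCAbelianSchemesRoadTwistedDoorPrimeIsoRespects
import Literature.AlgebraicGeometry.HodgeTheory.HardLefschetzNFoldHolds
import HarnessLib

/-!
# Road b02 (`VHCAbelianSchemesRoad`, D-0059) — the G1 node RESTRICTED TO PINNED TARGETS (`SecantQuotientPinnedAnchorLevelTransfer63 𝒪`, «G1♭»):
# node ⟺ G1♭ ∧ G3 with NO side hypothesis; what G1 says beyond G1♭ (an envelope statement about special level structures, not about carriers);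
# pin-scaling and chart-transport invariance of carried-ness; and the reduction of G1♭ to pairs of secant–quotient DATA at their identity charts
# (definitions and fact-free glue; lane R, crux `SemiregularSheafRepresentativesTwPrimeAtDiag`, item stmt-HodgeConjecture-20707, skeleton v3.3)

research route conditional on HC_CM; not a corollary; Q11.4-sentence-2 already refuted in dim ≥ 3.

DEFINITIONS AND FACT-FREE GLUE ONLY (`HC_CM` nowhere; nothing asserted; helper under the registered stub `stub_residual_63_secantQuotientPinnedPrime`,
director-hodge rulings R10.4 (2) ∕ R10.5 (3)(iii): «G1's first special-anchor closedness case — paper statement first as one typed ∀-lemma»). The G1 node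
of `…SecantQuotientAnchorLevelTransferDefs` (p561877) quantifies its TARGET anchor `(X, θ)` over the carriers' envelope `Markman2025.IsSecantQuotientAnchorWith d`
(any genus-3 curve, any pair of disjoint cyclic subgroups of order `d+1`, any chart, any pin — NO general position, any `d`), but concludes with a
PINNED-served class `w ∈ 𝔖^pin X θ`, whose witnesses are `SecantQuotientDatum`s (Lemma 9.3.1's general position, `d` even `≥ 4`, the polarisation ∕
ample-line ∕ hyperbolicity clauses). So G1 = TWO statements of different nature: (α) at every level-`d` anchor that IS pinned, carried-ness transfers
(«G1♭», THIS file's node — the closedness content proper); (β) every level-`d` anchor of a seeded level is pinned at all — an ENVELOPE statement about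
SPECIAL LEVEL STRUCTURES (translates `τ_{g₁+g₂}(Θ)` not in general position) that has nothing to do with carriers (§3: G1 ⟺ G1♭ ∧ (β)). The node of
ring2-b03x (`SecantQuotientWeilDirectionTransfer63`) only ever applies G1 at targets carrying a pinned-served class, so **node ⟺ G1♭ ∧ G3 EXACTLY** (§2; the
`hne` side hypothesis of p561877's `levelTransfer63_of_weilDirectionTransfer63` disappears), and the stub junction runs from G1♭ (§2). §4–§5: the
`∃`-clause «some rational pinned-served class is `𝒪`-carried at `(X, θ)`» is INVARIANT under rescaling the pin `θ ↦ q·θ`, `q ∈ ℚˣ` (`carriedClasses_smul_iff`,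
`IsSecantQuotientWeilClassAtPinned.ratSmul`) and under re-charting along isomorphisms for doors that respect isomorphisms (`carriedClasses_map_of_respectsIso`; the
primed door does: `twistedDoorPrime_respectsIso`, ring2-b06 g120), so §6: **G1♭ ⟺ its restriction to pairs of DATA `(D, D′)` at their identity charts
`(D.Y.X, h_Y(θ₀))`** (`SecantQuotientDatumLevelTransfer63`; `pinnedLevelTransfer63_iff_datum`), i.e. G1's content lives on the (curve, theta divisor, level
pair) moduli, level by level — where, reading arXiv:2502.03415 §9 as a ∀-statement (non-hyperelliptic `C` + Lemma 9.3.1's general position = every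
hypothesis of §9.1–9.3; Noether's theorem for the non-hyperelliptic curve enters Prop. «obstruction map has rank 6» and hence Lemma 9.3.11), the ONLY anchors
not served by print's construction are those of HYPERELLIPTIC curves: G1♭ = [print in ∀-form, citation-expected] ∧ [closedness across the hyperelliptic
divisor of the level family] (the typed split waits for a `Jacobian.IsHyperelliptic` predicate in `Literature/`; evidence memo of this seat).

Nothing here says G1, G1♭, (β), G3, the node, L1″, any stub ∕ cell ∕ rung ∕ crux, K-SR♭∃, VHC, `HC_AV`, `HC_CM` or HC holds.
References: [cite: Markman2025SecantWeil, §1.3 (p. 5), §1.5 (p. 7), Thm. 1.4.1 (item 4), Thm. 1.5.1, §9.1 Lemma 9.1.2 ∕ 9.1.4, §9.2 Prop. 9.2.2, §9.3 Lemma 9.3.1 and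
Lemma 9.3.11] [cite: BuchweitzFlenner2003, §5 Thm. 5.1] [cite: Bloch1972Semiregularity, Remark (7.5)] [cite: vanGeemen1994HodgeAV, Lemma 5.2 and 5.4]
[cite: Lange2023AbelianVarietiesComplex, §2.1.1 (p. 68)] [cite: VoisinHodgeI2002, Thm. 6.25] [cite: HatcherAT2002, Prop. 3.10].
-/

noncomputable section

open CategoryTheory CategoryTheory.Limits AlgebraicGeometry Topology

namespace Summit.HodgeConjecture.HodgeConjecture.Ring2.SemiregularRepresentatives

set_option linter.dupNamespace false -- the cell's namespace repeats the summit name, as in every `Ring2*` file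

open Literature.AlgebraicGeometry Literature.AlgebraicGeometry.Motives Literature.AlgebraicGeometry.Motives.AbelianVariety
open Literature.AlgebraicGeometry.HodgeTheory Literature.AlgebraicGeometry.Markman2025
open Literature.AlgebraicTopology.SingularHomology
open Summit.Ventures.HSemireg (ObjClass)
open Summit.HodgeConjecture.HodgeConjecture.Ring2.AbelianAll (carriedClasses)

/-! ## §1 G1♭: same-level transfer of carried-ness TO PINNED ANCHORS -/

/-- **G1♭ — SAME-LEVEL TRANSFER OF CARRIED-NESS TO EVERY PINNED ANCHOR at `(6,3)` (`SecantQuotientPinnedAnchorLevelTransfer63 𝒪`)**: for every level `d`,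
all level-`d` secant–quotient anchors with their class `(X, θ)`, `(X', θ')` (`Markman2025.IsSecantQuotientAnchorWith d`) such that the TARGET `(X, θ)` IS A
PINNED ANCHOR (`secantQuotientAnchorsPinned X θ`: a chart of some `SecantQuotientDatum` — general position, `d` even `≥ 4` — pinned to `h_Y(θ₀)`), **if some
rational pinned-served class is `𝒪`-carried at `(X', θ')` then some rational pinned-served class is `𝒪`-carried at `(X, θ)`**. This is p561877's G1 with its
target restricted to the pinned envelope — the part of G1 the node actually uses (§2: node ⟺ G1♭ ∧ G3) —; its content is CLOSEDNESS of carried-ness along the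
level family at the anchors print does not construct (hyperelliptic curves; module docstring). NOT IN PRINT; WHY IT MIGHT FAIL: Markman's semiregularity
proof (Lemma 9.3.11 via the rank-6 obstruction map) uses Noether's theorem for the non-hyperelliptic curve, the theta divisor `W₂` of a hyperelliptic
genus-3 curve is singular, and limits of semiregular sheaves need not be semiregular. OPEN; a HYPOTHESIS wherever used.
[cite: Markman2025SecantWeil, §1.5 (p. 7), Thm. 1.4.1 (item 4), §9.2 Prop. 9.2.2 and §9.3 Lemma 9.3.11] [cite: BuchweitzFlenner2003, §5 Thm. 5.1]
[cite: Bloch1972Semiregularity, Remark (7.5)] [status: open] -/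
@[conjecture] def SecantQuotientPinnedAnchorLevelTransfer63 (𝒪 : ObjClass) : Prop :=
  ∀ (d : ℕ) ⦃X X' : SchemeOver ℂ⦄ ⦃θ : complexBetti X 2⦄ ⦃θ' : complexBetti X' 2⦄,
    IsSecantQuotientAnchorWith d X θ → secantQuotientAnchorsPinned X θ → IsSecantQuotientAnchorWith d X' θ' →
    (∃ w' : complexBetti X' (2 * 3), w' ∈ secantQuotientServedClassesPinned X' θ' ∧ IsRationalClass w' ∧ w' ∈ carriedClasses 𝒪 6 3 X' θ') →
    ∃ w : complexBetti X (2 * 3), w ∈ secantQuotientServedClassesPinned X θ ∧ IsRationalClass w ∧ w ∈ carriedClasses 𝒪 6 3 X θ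

/-- **G1♭ for the PRIMED twisted door `tw C AdmTw′`**, `AdmTw′ := gluableSigmaAdmissible ∨ bfSingleAdmissible′` — the reading behind stub 2a‴ of skeleton v3.3
(item stmt-HodgeConjecture-20707). OPEN; a HYPOTHESIS wherever used. [cite: Markman2025SecantWeil, Thm. 1.4.1 (item 4), §1.5 and §9.3 Lemma 9.3.11]
[cite: BuchweitzFlenner2003, §5 Thm. 5.1] [cite: Pridham2024Semiregularity, Cor. 2.25 and Rem. 2.26] [status: open] -/
@[conjecture] def SecantQuotientPinnedAnchorLevelTransfer63PinnedPrime (C : ChernCharacterBetti) : Prop :=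
  SecantQuotientPinnedAnchorLevelTransfer63 (Literature.AlgebraicGeometry.HodgeTheory.twistedReflexiveClass C
    (fun n X₀ I E => Summit.Ventures.HSemireg.gluableSigmaAdmissible n X₀ I E ∨
      Literature.AlgebraicGeometry.HodgeTheory.bfSingleAdmissible' n X₀ I E))

/-- **G1♭ ON DATA (`SecantQuotientDatumLevelTransfer63 𝒪`)**: G1♭ with BOTH anchors at the IDENTITY CHARTS of secant–quotient data — target
`(D.Y.X, h_Y(θ₀))`, source `(D'.Y.X, h_{Y'}(θ₀'))`, `D, D'` `SecantQuotientDatum`s (curve, Jacobian, Riemann theta divisor, even level `≥ 4`, disjoint cyclic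
`G₁, G₂` of order `d+1`, translates in general position), `θ₀, θ₀'` any degree-2 classes on the Jacobians (the hypotheses cut them down). For doors that
respect isomorphisms it is EQUIVALENT to G1♭ (§6): G1's content lives on the (curve, theta divisor, level pair) moduli, level by level. OPEN; a HYPOTHESIS
wherever used. [cite: Markman2025SecantWeil, §1.5 (p. 7), Thm. 1.4.1 and §9.3 Lemma 9.3.1] [cite: Bloch1972Semiregularity, Remark (7.5)] [status: open] -/
@[conjecture] def SecantQuotientDatumLevelTransfer63 (𝒪 : ObjClass) : Prop :=
  ∀ (d : ℕ) (D D' : SecantQuotientDatum) ⦃θ₀ : complexBetti D.𝒥.J.X 2⦄ ⦃θ₀' : complexBetti D'.𝒥.J.X 2⦄,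
    IsSecantQuotientAnchorWith d D.Y.X (D.hY θ₀) → secantQuotientAnchorsPinned D.Y.X (D.hY θ₀) →
    IsSecantQuotientAnchorWith d D'.Y.X (D'.hY θ₀') →
    (∃ w' : complexBetti D'.Y.X (2 * 3), w' ∈ secantQuotientServedClassesPinned D'.Y.X (D'.hY θ₀') ∧ IsRationalClass w' ∧
      w' ∈ carriedClasses 𝒪 6 3 D'.Y.X (D'.hY θ₀')) →
    ∃ w : complexBetti D.Y.X (2 * 3), w ∈ secantQuotientServedClassesPinned D.Y.X (D.hY θ₀) ∧ IsRationalClass w ∧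
      w ∈ carriedClasses 𝒪 6 3 D.Y.X (D.hY θ₀)

variable {𝒪 : ObjClass} {C : ChernCharacterBetti}

/-- The primed G1♭, unfolded (definitional). [cite: Markman2025SecantWeil, Thm. 1.4.1] -/
theorem secantQuotientPinnedAnchorLevelTransfer63PinnedPrime_iff :
    SecantQuotientPinnedAnchorLevelTransfer63PinnedPrime C ↔
      SecantQuotientPinnedAnchorLevelTransfer63 (Literature.AlgebraicGeometry.HodgeTheory.twistedReflexiveClass C
        (fun n X₀ I E => Summit.Ventures.HSemireg.gluableSigmaAdmissible n X₀ I E ∨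
          Literature.AlgebraicGeometry.HodgeTheory.bfSingleAdmissible' n X₀ I E)) :=
  Iff.rfl

/-! ## §2 node ⟺ G1♭ ∧ G3 (no side hypothesis); G1 ⟹ G1♭; the stub junction from G1♭ -/

/-- **G1 ⟹ G1♭** (drop the pinned-target hypothesis). [cite: Markman2025SecantWeil, Thm. 1.4.1 (item 4)] -/
theorem pinnedLevelTransfer63_of_levelTransfer63 (h : SecantQuotientAnchorLevelTransfer63 𝒪) :
    SecantQuotientPinnedAnchorLevelTransfer63 𝒪 :=
  fun d _ _ _ _ hX _ hX' hsrc ↦ h d hX hX' hsrc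

/-- **G1♭ ∧ G3 ⟹ ring2-b03x's node** (G3 displayed inline, as in p561877): the node's target comes WITH a pinned-served class, so the target is a pinned
anchor and G1♭ suffices where p561877 used G1. [cite: Markman2025SecantWeil, Thm. 1.4.1 (item 4) and Thm. 1.5.1] [cite: Bloch1972Semiregularity, Remark (7.5)] -/
theorem weilDirectionTransfer63_of_pinnedLevelTransfer_of_sameAnchor (hG1 : SecantQuotientPinnedAnchorLevelTransfer63 𝒪)
    (hG3 : ∀ (d : ℕ) ⦃X : SchemeOver ℂ⦄ ⦃θ : complexBetti X 2⦄ ⦃w w' : complexBetti X (2 * 3)⦄,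
      IsSecantQuotientAnchorWith d X θ → w ∈ secantQuotientServedClassesPinned X θ → IsRationalClass w →
      w' ∈ secantQuotientServedClassesPinned X θ → IsRationalClass w' → w' ∈ carriedClasses 𝒪 6 3 X θ →
      w ∈ carriedClasses 𝒪 6 3 X θ) :
    SecantQuotientWeilDirectionTransfer63 𝒪 := by
  intro d X X' θ θ' w w' hX hw hwQ hX' hw' hw'Q hc
  obtain ⟨w₀, hw₀, hw₀Q, hc₀⟩ := hG1 d hX (secantQuotientAnchorsPinned_of_mem hw) hX' ⟨w', hw', hw'Q, hc⟩
  exact hG3 d hX hw hwQ hw₀ hw₀Q hc₀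

/-- **The node ⟹ G1♭, with NO side hypothesis** (contrast p561877's `levelTransfer63_of_weilDirectionTransfer63`, which needs a rational pinned-served class at
every target: a pinned target HAS one — its witness, rational by definition). [cite: Markman2025SecantWeil, Thm. 1.4.1 (item 4)] -/
theorem pinnedLevelTransfer63_of_weilDirectionTransfer63 (hN : SecantQuotientWeilDirectionTransfer63 𝒪) :
    SecantQuotientPinnedAnchorLevelTransfer63 𝒪 := by
  intro d X X' θ θ' hX hpin hX' ⟨w', hw', hw'Q, hc⟩
  obtain ⟨γ, hγ⟩ := hpin
  exact ⟨γ, hγ, hγ.isRationalClass, hN d hX hγ hγ.isRationalClass hX' hw' hw'Q hc⟩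

/-- **node ⟺ G1♭ ∧ G3** — EXACTLY, no side hypothesis: ring2-b03x's `SecantQuotientWeilDirectionTransfer63 𝒪` is the conjunction of the lane-R half (G1♭,
across the pinned anchors of a level) and the lane-W1 half (G3, the other rational directions at one anchor).
[cite: Markman2025SecantWeil, Thm. 1.4.1 (item 4) and Thm. 1.5.1] [cite: Bloch1972Semiregularity, Remark (7.5)] -/
theorem weilDirectionTransfer63_iff_pinnedLevelTransfer_and_sameAnchor :
    SecantQuotientWeilDirectionTransfer63 𝒪 ↔
      SecantQuotientPinnedAnchorLevelTransfer63 𝒪 ∧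
      ∀ (d : ℕ) ⦃X : SchemeOver ℂ⦄ ⦃θ : complexBetti X 2⦄ ⦃w w' : complexBetti X (2 * 3)⦄,
        IsSecantQuotientAnchorWith d X θ → w ∈ secantQuotientServedClassesPinned X θ → IsRationalClass w →
        w' ∈ secantQuotientServedClassesPinned X θ → IsRationalClass w' → w' ∈ carriedClasses 𝒪 6 3 X θ →
        w ∈ carriedClasses 𝒪 6 3 X θ :=
  ⟨fun hN ↦ ⟨pinnedLevelTransfer63_of_weilDirectionTransfer63 hN, sameAnchorTransfer63_of_weilDirectionTransfer63 hN⟩,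
    fun h ↦ weilDirectionTransfer63_of_pinnedLevelTransfer_of_sameAnchor h.1 h.2⟩

/-- The primed instance: `SecantQuotientWeilDirectionTransfer63PinnedPrime C ↔ G1♭′(C) ∧ G3′(C)`. [cite: Markman2025SecantWeil, Thm. 1.4.1 (item 4)] -/
theorem weilDirectionTransfer63PinnedPrime_iff_pinnedLevelTransfer_and_sameAnchor :
    SecantQuotientWeilDirectionTransfer63PinnedPrime C ↔
      SecantQuotientPinnedAnchorLevelTransfer63PinnedPrime C ∧
      ∀ (d : ℕ) ⦃X : SchemeOver ℂ⦄ ⦃θ : complexBetti X 2⦄ ⦃w w' : complexBetti X (2 * 3)⦄,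
        IsSecantQuotientAnchorWith d X θ → w ∈ secantQuotientServedClassesPinned X θ → IsRationalClass w →
        w' ∈ secantQuotientServedClassesPinned X θ → IsRationalClass w' →
        w' ∈ carriedClasses (Literature.AlgebraicGeometry.HodgeTheory.twistedReflexiveClass C
          (fun n X₀ I E => Summit.Ventures.HSemireg.gluableSigmaAdmissible n X₀ I E ∨
            Literature.AlgebraicGeometry.HodgeTheory.bfSingleAdmissible' n X₀ I E)) 6 3 X θ →
        w ∈ carriedClasses (Literature.AlgebraicGeometry.HodgeTheory.twistedReflexiveClass C
          (fun n X₀ I E => Summit.Ventures.HSemireg.gluableSigmaAdmissible n X₀ I E ∨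
            Literature.AlgebraicGeometry.HodgeTheory.bfSingleAdmissible' n X₀ I E)) 6 3 X θ :=
  weilDirectionTransfer63_iff_pinnedLevelTransfer_and_sameAnchor

/-- **STUB 2a‴ FROM PRINT, G1♭ AND G3: `L1″(C, AdmTw′) ∧ G1♭′ ∧ G3′ ⟹ SecantQuotientAnchorCarrier63PinnedPrime C`** (ring2-b03x's junction with the node
assembled from the two halves; G1♭ replaces G1). Nothing here says any input holds. [cite: Markman2025SecantWeil, Thm. 1.4.1 (item 4), §1.5, Thm. 1.5.1 and Lemma 9.3.11]
[cite: Bloch1972Semiregularity, Remark (7.5)] [cite: BuchweitzFlenner2003, §5 Thm. 5.1] -/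
theorem secantQuotientAnchorCarrier63PinnedPrime_of_pinned_of_pinnedLevelTransfer_of_sameAnchor
    (hM : Markman2025_secantQuotient_twistedCarrier_onJacobian_pinned C
      (fun n X₀ I E => Summit.Ventures.HSemireg.gluableSigmaAdmissible n X₀ I E ∨
        Literature.AlgebraicGeometry.HodgeTheory.bfSingleAdmissible' n X₀ I E))
    (hG1 : SecantQuotientPinnedAnchorLevelTransfer63PinnedPrime C)
    (hG3 : ∀ (d : ℕ) ⦃X : SchemeOver ℂ⦄ ⦃θ : complexBetti X 2⦄ ⦃w w' : complexBetti X (2 * 3)⦄,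
      IsSecantQuotientAnchorWith d X θ → w ∈ secantQuotientServedClassesPinned X θ → IsRationalClass w →
      w' ∈ secantQuotientServedClassesPinned X θ → IsRationalClass w' →
      w' ∈ carriedClasses (Literature.AlgebraicGeometry.HodgeTheory.twistedReflexiveClass C
        (fun n X₀ I E => Summit.Ventures.HSemireg.gluableSigmaAdmissible n X₀ I E ∨
          Literature.AlgebraicGeometry.HodgeTheory.bfSingleAdmissible' n X₀ I E)) 6 3 X θ →
      w ∈ carriedClasses (Literature.AlgebraicGeometry.HodgeTheory.twistedReflexiveClass C
        (fun n X₀ I E => Summit.Ventures.HSemireg.gluableSigmaAdmissible n X₀ I E ∨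
          Literature.AlgebraicGeometry.HodgeTheory.bfSingleAdmissible' n X₀ I E)) 6 3 X θ) :
    SecantQuotientAnchorCarrier63PinnedPrime C :=
  secantQuotientAnchorCarrier63PinnedPrime_of_pinned_of_weilDirectionTransfer hM
    (weilDirectionTransfer63_of_pinnedLevelTransfer_of_sameAnchor hG1 hG3)

/-! ## §3 What G1 says beyond G1♭: an envelope statement about special level structures -/

/-- **G1 FORCES EVERY level-`d` anchor of a SEEDED level to be a PINNED anchor** — it turns the existence of one carried pinned-served class somewhere at
level `d` into «every `(X, θ)` with `IsSecantQuotientAnchorWith d X θ` (any curve, any disjoint cyclic pair — translates in general position or NOT —, any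
`d`) is a chart of a `SecantQuotientDatum` pinned to `h_Y(θ₀)`»: a statement about SPECIAL LEVEL STRUCTURES and the polarisation clauses that has nothing to do
with carriers (the artefact G1♭ removes). [cite: Markman2025SecantWeil, §1.5 (p. 7) and §9.3 Lemma 9.3.1] -/
theorem secantQuotientAnchorsPinned_of_levelTransfer63 (h : SecantQuotientAnchorLevelTransfer63 𝒪) {d : ℕ}
    (hseed : ∃ (X' : SchemeOver ℂ) (θ' : complexBetti X' 2) (w' : complexBetti X' (2 * 3)),
      IsSecantQuotientAnchorWith d X' θ' ∧ w' ∈ secantQuotientServedClassesPinned X' θ' ∧ IsRationalClass w' ∧ w' ∈ carriedClasses 𝒪 6 3 X' θ')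
    ⦃X : SchemeOver ℂ⦄ ⦃θ : complexBetti X 2⦄ (hX : IsSecantQuotientAnchorWith d X θ) : secantQuotientAnchorsPinned X θ := by
  obtain ⟨X', θ', w', hX', hw', hw'Q, hc⟩ := hseed
  obtain ⟨w, hw, -, -⟩ := h d hX hX' ⟨w', hw', hw'Q, hc⟩
  exact secantQuotientAnchorsPinned_of_mem hw

/-- **G1 ⟺ G1♭ ∧ (β)**, (β) := «at every level carrying a carried pinned-served class, every level-`d` anchor is pinned» — the clean separation of the
closedness content (G1♭) from the envelope artefact (β). [cite: Markman2025SecantWeil, §1.5 (p. 7), Thm. 1.4.1 and §9.3 Lemma 9.3.1] -/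
theorem levelTransfer63_iff_pinned_and_envelope :
    SecantQuotientAnchorLevelTransfer63 𝒪 ↔
      SecantQuotientPinnedAnchorLevelTransfer63 𝒪 ∧
      ∀ (d : ℕ), (∃ (X' : SchemeOver ℂ) (θ' : complexBetti X' 2) (w' : complexBetti X' (2 * 3)),
          IsSecantQuotientAnchorWith d X' θ' ∧ w' ∈ secantQuotientServedClassesPinned X' θ' ∧ IsRationalClass w' ∧ w' ∈ carriedClasses 𝒪 6 3 X' θ') →
        ∀ ⦃X : SchemeOver ℂ⦄ ⦃θ : complexBetti X 2⦄, IsSecantQuotientAnchorWith d X θ → secantQuotientAnchorsPinned X θ := by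
  refine ⟨fun h ↦ ⟨pinnedLevelTransfer63_of_levelTransfer63 h, fun d hseed X θ hX ↦ secantQuotientAnchorsPinned_of_levelTransfer63 h hseed hX⟩,
    fun ⟨h, hβ⟩ d X X' θ θ' hX hX' hsrc ↦ ?_⟩
  obtain ⟨w', hw', hw'Q, hc⟩ := hsrc
  exact h d hX (hβ d ⟨X', θ', w', hX', hw', hw'Q, hc⟩ hX) hX' ⟨w', hw', hw'Q, hc⟩

/-! ## §4 Pin scaling: `θ ↦ c·θ`, `c ≠ 0`, changes neither carried-ness nor (for `c ∈ ℚˣ`) the pinned served set -/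

section Scaling

variable {n p : ℕ} {X : SchemeOver ℂ} {θ : complexBetti X 2}

/-- Carried-ness modulo the ray `ℂ·θ` persists after rescaling the generator: `w ∈ carriedClasses 𝒪 n p X θ → w ∈ carriedClasses 𝒪 n p X (c·θ)` for `c ≠ 0`
(`(c·θ)^q = c^q·θ^q`: the side scalars rescale by `c^{-q}`, the datum and the leading coefficient do not move). [cite: HatcherAT2002, §3.2]
[cite: Bloch1972Semiregularity, Remark (7.5)] -/
theorem carriedClasses_smul_of_mem {c : ℂ} (hc : c ≠ 0) {w : complexBetti X (2 * p)} (hw : w ∈ carriedClasses 𝒪 n p X θ) :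
    w ∈ carriedClasses 𝒪 n p X (c • θ) := by
  obtain ⟨I, κ, a, s, hpI, h𝒪, ha, hκp, hκq⟩ := hw
  refine ⟨I, κ, a, fun q ↦ s q * (c ^ q)⁻¹, hpI, h𝒪, ha, ?_, fun q hq hqp ↦ ?_⟩
  · rw [hκp, cupPowTwo_smul, smul_smul, inv_mul_cancel_right₀ (pow_ne_zero p hc)]
  · rw [hκq q hq hqp, cupPowTwo_smul, smul_smul, inv_mul_cancel_right₀ (pow_ne_zero q hc)]

/-- **Carried-ness modulo the ray is insensitive to rescaling the ray's generator**: `w ∈ carriedClasses 𝒪 n p X (c·θ) ↔ w ∈ carriedClasses 𝒪 n p X θ`,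
`c ≠ 0`. [cite: HatcherAT2002, §3.2] [cite: Bloch1972Semiregularity, Remark (7.5)] -/
theorem carriedClasses_smul_iff {c : ℂ} (hc : c ≠ 0) {w : complexBetti X (2 * p)} :
    w ∈ carriedClasses 𝒪 n p X (c • θ) ↔ w ∈ carriedClasses 𝒪 n p X θ := by
  refine ⟨fun hw ↦ ?_, carriedClasses_smul_of_mem hc⟩
  have h := carriedClasses_smul_of_mem (inv_ne_zero hc) hw
  rwa [smul_smul, inv_mul_cancel₀ hc, one_smul] at h

/-- Polarisation classes (rational, divisorial, hard Lefschetz) are stable under `ℚˣ` — the tree's notion carries no positivity.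
[cite: VoisinHodgeI2002, Thm. 6.25] [cite: Andre1996Motifs, §1.1 (p. 10)] -/
private theorem isPolarizationClass_ratSmul {m : ℕ} (hp : IsPolarizationClass m X θ) {q : ℚ} (hq : q ≠ 0) :
    IsPolarizationClass m X ((q : ℂ) • θ) :=
  ⟨hp.isRationalClass.smul q, Submodule.smul_mem _ _ hp.mem_algebraicClasses,
    Literature.AlgebraicGeometry.HodgeTheory.HasHardLefschetzProperty.smul hp.hasHardLefschetz (by exact_mod_cast hq)⟩

/-- **The PINNED served set is `ℚˣ`-saturated in the polarisation**: `γ ∈ 𝔖^pin X θ → γ ∈ 𝔖^pin X (q·θ)` for `q ∈ ℚˣ` — same datum, same chart, pin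
`q·θ₀` (`h_Y` is linear, `IsPolarizationClassOf Θ` is `ℚˣ`-saturated), polarisation ∕ ample-line ∕ hyperbolicity clauses rescale
(`isHyperbolicWeilType_smul_iff`), the ray `ℂ·(qθ)³ = ℂ·θ³` and the Weil clause on `γ` are unchanged. [cite: Markman2025SecantWeil, §1.5 (p. 7) and §3.2 Cor. 3.2.3]
[cite: Lange2023AbelianVarietiesComplex, §2.1.1 (p. 68)] [cite: vanGeemen1994HodgeAV, Lemma 5.2 and 5.4] -/
theorem IsSecantQuotientWeilClassAtPinned.ratSmul {γ : complexBetti X (2 * 3)} (h : IsSecantQuotientWeilClassAtPinned X θ γ) {q : ℚ}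
    (hq : q ≠ 0) : IsSecantQuotientWeilClassAtPinned X ((q : ℂ) • θ) γ := by
  have hq' : (q : ℂ) ≠ 0 := by exact_mod_cast hq
  obtain ⟨D, e, θ₀, hθ₀, hpin, hpol, ⟨H, hH, hHθ⟩, hW, hγQ, hray, hmem⟩ := h
  refine ⟨D, e, (q : ℂ) • θ₀, hθ₀.smul hq, ?_, isPolarizationClass_ratSmul hpol hq, ⟨H, hH, ?_⟩, ?_, hγQ, ?_, hmem⟩
  · rw [map_smul, hpin]
    change _ = secantPolarizationClass D.𝒥.J D.isAmple D.G₁ D.G₂ D.succ_ne_zero D.G₁_le D.G₂_le D.d ((q : ℂ) • θ₀)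
    rw [secantPolarizationClass_smul]
    rfl
  · rw [map_smul]; exact hHθ.smul hq
  · rw [map_smul, map_smul]; exact (isHyperbolicWeilType_smul_iff hq').2 hW
  · rw [cupPowTwo_smul, Submodule.span_singleton_smul_eq (pow_ne_zero 3 hq').isUnit]; exact hray

/-- `𝔖^pin X (q·θ) = 𝔖^pin X θ` for `q ∈ ℚˣ`. [cite: Markman2025SecantWeil, §1.5 (p. 7)] [cite: Lange2023AbelianVarietiesComplex, §2.1.1 (p. 68)] -/
theorem secantQuotientServedClassesPinned_ratSmul {q : ℚ} (hq : q ≠ 0) :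
    secantQuotientServedClassesPinned X ((q : ℂ) • θ) = secantQuotientServedClassesPinned X θ := by
  ext γ
  refine ⟨fun h ↦ ?_, fun h ↦ IsSecantQuotientWeilClassAtPinned.ratSmul h hq⟩
  have h' := IsSecantQuotientWeilClassAtPinned.ratSmul h (inv_ne_zero hq)
  rwa [Rat.cast_inv, smul_smul, inv_mul_cancel₀ (show (q : ℂ) ≠ 0 by exact_mod_cast hq), one_smul] at h'

/-- `𝔄^pin X (q·θ) ↔ 𝔄^pin X θ` for `q ∈ ℚˣ`. [cite: Markman2025SecantWeil, §1.5 (p. 7)] -/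
theorem secantQuotientAnchorsPinned_ratSmul_iff {q : ℚ} (hq : q ≠ 0) :
    secantQuotientAnchorsPinned X ((q : ℂ) • θ) ↔ secantQuotientAnchorsPinned X θ := by
  simp only [secantQuotientAnchorsPinned_iff, secantQuotientServedClassesPinned_ratSmul hq]

/-- **The G1-clause «some rational pinned-served class is `𝒪`-carried at `(X, θ)`» is invariant under `θ ↦ q·θ`, `q ∈ ℚˣ`** — so in G1 ∕ G1♭ the pin
modulus `θ₀ ∈ ℚˣ·[Θ]` of source and target is idle (and so is `IsSecantQuotientAnchorWith d`, `Markman2025.IsSecantQuotientAnchorWith.smul`).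
[cite: Markman2025SecantWeil, §1.5 (p. 7)] [cite: Bloch1972Semiregularity, Remark (7.5)] -/
theorem exists_carried_pinned_ratSmul_iff {q : ℚ} (hq : q ≠ 0) :
    (∃ w : complexBetti X (2 * 3), w ∈ secantQuotientServedClassesPinned X ((q : ℂ) • θ) ∧ IsRationalClass w ∧
        w ∈ carriedClasses 𝒪 6 3 X ((q : ℂ) • θ)) ↔
      ∃ w : complexBetti X (2 * 3), w ∈ secantQuotientServedClassesPinned X θ ∧ IsRationalClass w ∧ w ∈ carriedClasses 𝒪 6 3 X θ := by
  simp only [secantQuotientServedClassesPinned_ratSmul hq, carriedClasses_smul_iff (show (q : ℂ) ≠ 0 by exact_mod_cast hq)]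

end Scaling

/-! ## §5 Chart transport: for a door that respects isomorphisms, carried-ness moves along `e : X ≅ X'` -/

section Transport

variable {n p : ℕ}

/-- **Carried-ness transports along isomorphisms of `ℂ`-schemes for a door that RESPECTS ISOMORPHISMS** (displayed shape `hresp`, the one proved for both
twisted doors: `twistedDoor_respectsIso`, `twistedDoorPrime_respectsIso`): `w ∈ carriedClasses 𝒪 n p X' θ' ⟹ e^*w ∈ carriedClasses 𝒪 n p X (e^*θ')` for
`e : X ≅ X'` (transport the datum `κ ↦ e^*κ`; `e^*` is linear and multiplicative on cup powers). [cite: HatcherAT2002, Prop. 3.10] [cite: Bloch1972Semiregularity, Remark (7.5)] -/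
theorem carriedClasses_map_of_respectsIso
    (hresp : ∀ (n : ℕ) ⦃Y Y' : SchemeOver ℂ⦄ (e : Y' ≅ Y) (I : Finset ℕ) (κ : (q : ℕ) → complexBetti Y (2 * q)),
      𝒪 n Y I κ → 𝒪 n Y' I (fun q ↦ complexBetti.map e.hom (2 * q) (κ q)))
    ⦃X X' : SchemeOver ℂ⦄ (e : X ≅ X') {θ' : complexBetti X' 2} {w : complexBetti X' (2 * p)} (hw : w ∈ carriedClasses 𝒪 n p X' θ') :
    complexBetti.map e.hom (2 * p) w ∈ carriedClasses 𝒪 n p X (complexBetti.map e.hom 2 θ') := by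
  obtain ⟨I, κ, a, s, hpI, h𝒪, ha, hκp, hκq⟩ := hw
  refine ⟨I, fun q ↦ complexBetti.map e.hom (2 * q) (κ q), a, s, hpI, hresp n e I κ h𝒪, ha, ?_, fun q hq hqp ↦ ?_⟩
  · change complexBetti.map e.hom (2 * p) (κ p) = _
    rw [hκp, map_add, map_smul, map_smul, map_cupPowTwo]
  · change complexBetti.map e.hom (2 * q) (κ q) = _
    rw [hκq q hq hqp, map_smul, map_cupPowTwo]

/-- **The G1-clause transports along isomorphisms** (door respecting isomorphisms): if some rational pinned-served class is carried at `(X', θ')` then some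
is carried at `(X, e^*θ')`, `e : X ≅ X'` (`IsSecantQuotientWeilClassAtPinned.of_iso`, `IsRationalClass.map`, `carriedClasses_map_of_respectsIso`).
[cite: Markman2025SecantWeil, Thm. 1.4.1] [cite: HatcherAT2002, Prop. 3.10] -/
theorem exists_carried_pinned_map_of_respectsIso
    (hresp : ∀ (n : ℕ) ⦃Y Y' : SchemeOver ℂ⦄ (e : Y' ≅ Y) (I : Finset ℕ) (κ : (q : ℕ) → complexBetti Y (2 * q)),
      𝒪 n Y I κ → 𝒪 n Y' I (fun q ↦ complexBetti.map e.hom (2 * q) (κ q)))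
    ⦃X X' : SchemeOver ℂ⦄ (e : X ≅ X') {θ' : complexBetti X' 2}
    (h : ∃ w' : complexBetti X' (2 * 3), w' ∈ secantQuotientServedClassesPinned X' θ' ∧ IsRationalClass w' ∧ w' ∈ carriedClasses 𝒪 6 3 X' θ') :
    ∃ w : complexBetti X (2 * 3), w ∈ secantQuotientServedClassesPinned X (complexBetti.map e.hom 2 θ') ∧ IsRationalClass w ∧
      w ∈ carriedClasses 𝒪 6 3 X (complexBetti.map e.hom 2 θ') := by
  obtain ⟨w', hw', hw'Q, hc⟩ := h
  exact ⟨_, IsSecantQuotientWeilClassAtPinned.of_iso e hw', hw'Q.map _, carriedClasses_map_of_respectsIso hresp e hc⟩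

end Transport

/-! ## §6 Reduction of G1♭ to pairs of DATA at their identity charts -/

/-- **G1♭ ⟹ G1♭ on data** (specialisation to identity charts). [cite: Markman2025SecantWeil, §1.5 (p. 7)] -/
theorem datumLevelTransfer63_of_pinnedLevelTransfer63 (h : SecantQuotientPinnedAnchorLevelTransfer63 𝒪) :
    SecantQuotientDatumLevelTransfer63 𝒪 :=
  fun d _ _ _ _ hX hpin hX' hsrc ↦ h d hX hpin hX' hsrc

/-- **G1♭ on data ⟹ G1♭, for a door that respects isomorphisms**: move the source `(X', θ')` to the identity chart of the datum of its carried pinned-served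
class (`e'⁻¹^*θ' = h_{Y'}(θ₀')` is the pin) and the target `(X, θ)` to the identity chart of the datum of its pinning class, apply the datum statement, and
carry the conclusion back along the target's chart (§5). [cite: Markman2025SecantWeil, §1.5 (p. 7) and Thm. 1.4.1] [cite: HatcherAT2002, Prop. 3.10]
[cite: Bloch1972Semiregularity, Remark (7.5)] -/
theorem pinnedLevelTransfer63_of_datum_of_respectsIso
    (hresp : ∀ (n : ℕ) ⦃Y Y' : SchemeOver ℂ⦄ (e : Y' ≅ Y) (I : Finset ℕ) (κ : (q : ℕ) → complexBetti Y (2 * q)),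
      𝒪 n Y I κ → 𝒪 n Y' I (fun q ↦ complexBetti.map e.hom (2 * q) (κ q)))
    (h : SecantQuotientDatumLevelTransfer63 𝒪) : SecantQuotientPinnedAnchorLevelTransfer63 𝒪 := by
  intro d X X' θ θ' hX hpin hX' hsrc
  -- the target's pin
  obtain ⟨γ, hγ⟩ := hpin
  obtain ⟨D, e, θ₀, -, hθ⟩ := IsSecantQuotientWeilClassAtPinned.exists_pin hγ
  -- the source's pin (from its carried pinned-served class)
  obtain ⟨w', hw', hw'Q, hc⟩ := hsrc
  obtain ⟨D', e', θ₀', -, hθ'⟩ := IsSecantQuotientWeilClassAtPinned.exists_pin hw'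
  -- move both to identity charts
  have hXD : IsSecantQuotientAnchorWith d D.Y.X (D.hY θ₀) := by rw [← hθ]; exact hX.map_iso e.symm
  have hpinD : secantQuotientAnchorsPinned D.Y.X (D.hY θ₀) := by
    rw [← hθ]; exact ⟨_, secantQuotientServedClassesPinned_transport e hγ⟩
  have hXD' : IsSecantQuotientAnchorWith d D'.Y.X (D'.hY θ₀') := by rw [← hθ']; exact hX'.map_iso e'.symm
  have hsrcD' : ∃ v : complexBetti D'.Y.X (2 * 3), v ∈ secantQuotientServedClassesPinned D'.Y.X (D'.hY θ₀') ∧ IsRationalClass v ∧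
      v ∈ carriedClasses 𝒪 6 3 D'.Y.X (D'.hY θ₀') := by
    rw [← hθ']
    exact exists_carried_pinned_map_of_respectsIso hresp e'.symm ⟨w', hw', hw'Q, hc⟩
  -- apply the datum statement and come back along `e`
  obtain ⟨v, hv, hvQ, hvc⟩ := h d D D' hXD hpinD hXD' hsrcD'
  have hback := exists_carried_pinned_map_of_respectsIso hresp e ⟨v, hv, hvQ, hvc⟩
  rwa [← hθ, e.complexBetti_map_hom_map_inv] at hback

/-- **G1♭ ⟺ G1♭ on data, for every door that respects isomorphisms** — G1's content lives on the (curve, theta divisor, level pair) moduli.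
[cite: Markman2025SecantWeil, §1.5 (p. 7) and §9.3 Lemma 9.3.1] [cite: Bloch1972Semiregularity, Remark (7.5)] -/
theorem pinnedLevelTransfer63_iff_datum
    (hresp : ∀ (n : ℕ) ⦃Y Y' : SchemeOver ℂ⦄ (e : Y' ≅ Y) (I : Finset ℕ) (κ : (q : ℕ) → complexBetti Y (2 * q)),
      𝒪 n Y I κ → 𝒪 n Y' I (fun q ↦ complexBetti.map e.hom (2 * q) (κ q))) :
    SecantQuotientPinnedAnchorLevelTransfer63 𝒪 ↔ SecantQuotientDatumLevelTransfer63 𝒪 :=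
  ⟨datumLevelTransfer63_of_pinnedLevelTransfer63, pinnedLevelTransfer63_of_datum_of_respectsIso hresp⟩

/-- **The primed instance, unconditionally**: `G1♭′(C) ⟺ G1♭ on data for `tw C AdmTw′`. [cite: Markman2025SecantWeil, §1.5 (p. 7)]
[cite: BuchweitzFlenner2003, §5 Thm. 5.1] -/
theorem pinnedLevelTransfer63PinnedPrime_iff_datum :
    SecantQuotientPinnedAnchorLevelTransfer63PinnedPrime C ↔
      SecantQuotientDatumLevelTransfer63 (Literature.AlgebraicGeometry.HodgeTheory.twistedReflexiveClass C
        (fun n X₀ I E => Summit.Ventures.HSemireg.gluableSigmaAdmissible n X₀ I E ∨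
          Literature.AlgebraicGeometry.HodgeTheory.bfSingleAdmissible' n X₀ I E)) :=
  pinnedLevelTransfer63_iff_datum (twistedDoorPrime_respectsIso C)

/-- **On data the pin moduli are idle**: the datum statement's clauses at `(D.Y.X, h_Y(q·θ₀)) = (D.Y.X, q·h_Y(θ₀))` are those at `(D.Y.X, h_Y(θ₀))` for `q ∈ ℚˣ`
(§4 and `Markman2025.IsSecantQuotientAnchorWith.smul`); recorded pointwise for the carried clause. [cite: Markman2025SecantWeil, §1.5 (p. 7) and §3.2 Cor. 3.2.3] -/
theorem exists_carried_pinned_hY_ratSmul_iff (D : SecantQuotientDatum) (θ₀ : complexBetti D.𝒥.J.X 2) {q : ℚ} (hq : q ≠ 0) :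
    (∃ w : complexBetti D.Y.X (2 * 3), w ∈ secantQuotientServedClassesPinned D.Y.X (D.hY ((q : ℂ) • θ₀)) ∧ IsRationalClass w ∧
        w ∈ carriedClasses 𝒪 6 3 D.Y.X (D.hY ((q : ℂ) • θ₀))) ↔
      ∃ w : complexBetti D.Y.X (2 * 3), w ∈ secantQuotientServedClassesPinned D.Y.X (D.hY θ₀) ∧ IsRationalClass w ∧
        w ∈ carriedClasses 𝒪 6 3 D.Y.X (D.hY θ₀) := by
  rw [SecantQuotientDatum.hY_def, secantPolarizationClass_smul, ← SecantQuotientDatum.hY_def]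
  exact exists_carried_pinned_ratSmul_iff hq

end Summit.HodgeConjecture.HodgeConjecture.Ring2.SemiregularRepresentatives

end
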